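import Summits.QuantumFields.YangMills.Theorems.FluctuationComparisonRegPrIntLS2BetaGaugeTransitionStep
import Literature.MathematicalPhysics.QuantumFieldTheory.Balaban1983to89.T4CubeChartGnomonic
import HarnessLib

/-!
# S2β · D-GUARD ∕ (BG∞) — (L-Σ) PART 1∕5: THE EIGHT-COLOUR TABLE of the sections and the «section × transition» step identity (UV3-NODE §116 ADD.2)

Cell `ym3-torus` (YM ladder rung R3 = continuum `SU(2)` Yang–Mills on the three-torus at fixed lattice data — a RUNG: NOT d = 4, NOT infinite volume,
NOT a mass gap, NOT Clay).  Width seat «width 19» `ym3-torus-px19` (gen 25, ★p1 lineage), FREE px helper on crux `stmt-QuantumFields-20520`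
(`FluctuationComparisonRegPrIntL`; registry `Lines/semiclassical_s2beta.lean` UNTOUCHED, 0∕5); `--kind proof --supports stmt-QuantumFields-20520 --as helper`,
count-neutral, DEFINITION-FREE (0 `def`, 0 `instance`, 0 `notation`, 0 `sorry`, default heartbeats).  (BG∞) plan of record: UV3-NODE §116 + ADD.1 + ADD.2
(architect ruling px17 g23 2026-09-01T00:13:02Z; desk RULINGs №123 ∕ №127 (binder style) ∕ №132-A; LEAD RULINGs №66 ∕ №67).

WHY.  The sections theorem `hSec` (the ONE displayed hypothesis of ✓`hBG_of_sections`) is assembled from block-local fillings by STAGE = number of odd axes of the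
parity block `Q : Fin 3 → Fin M` (its «colour»).  This file fixes the currency: the section `w Q` is READ from a table on the three parity flags of `Q` — `1` at
colour `(0,0,0)`, the stage-1 filling `W₁ Q α` when exactly `α` is odd, the stage-2 filling `W₂ Q α β` when exactly `α, β` are odd, the stage-3 filling `W₃ Q` at
`(1,1,1)` — together with the truncated tables `wle1` (stages ≤ 1) and `wle2` (stages ≤ 2) through which a higher stage reads the lower ones.  All three tables are
PINNED by displayed equations (`hw`, `hwle1`, `hwle2`); nothing is defined.

WHAT IS PROVED (sorry-free).  §1 ★`dist1_mul_mul_inv_mul_le` — `dist1 ((w₁t₁)(w₂t₂)⁻¹) ≤ dist1 (w₁w₂⁻¹) + dist1 (t₁⁻¹t₂)` in any gauge group ((Σ-1) of ADD.2).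
§2 table readings `w_eq_one`, `w_eq_W1`, `w_eq_W2`, `w_eq_W3`, and the truncation lemmas `wle1_eq_w` (off the stage-≥2 colours), `wle2_eq_w` (off `(1,1,1)`).

HONEST SCOPE.  Bookkeeping and group algebra over DISPLAYED hypotheses (the eight-colour table and the filling data are carried as functions PINNED by displayed
equations, in the style of ✓p839983's `hW`; nothing is defined).  The three FILLING LETTERS are HYPOTHESES of the final theorem (file (Σ-B5)); until they are
discharged ((L-I) ✓p839983, (L-T)∕(R3) px5, (L-S) px8, with the cone-centre lemmas (B3′)∕(B3-S)) `hSec`, hence `hBG`, (BG∞), `hsupp⁺` and D-GUARD's two `hsupp`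
letters are NOT proved.  Nothing of Bałaban's renormalisation-group analysis is asserted or proved ([Balaban1985RegularSpaces] Lemma 1 p.79 ∕ (1.29) p.81 is the
local, non-uniform statement in print; the N-uniform torus gluing is the (BG∞) plan's, NOT in print).  GAP♯∘ (`stub_uniformFibreGapOrbit`, registry UNTOUCHED), the
five registered stubs (0∕5), S2β, 20520, 19936, 19200, `YM3TorusSU2` are NOT proved; no registered stub is closed; rung R3 — NOT d = 4, NOT infinite volume, NOT a
mass gap, NOT Clay; the Yang–Mills mass gap is NOT proved.  Axioms standard.

References: T. Bałaban, CMP **99** (1985) 75–102 [Balaban1985RegularSpaces] (Lemma 1 p.79, (1.29) p.81).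
-/

set_option autoImplicit false

namespace Summit.QuantumFields.YangMills.Theorems.FluctuationComparisonRegPrIntLS2BetaSectionsColourTable

open Literature.MathematicalPhysics.QuantumFieldTheory.Balaban1983to89
open T4CubeChartGnomonic (SU2)

/-! ## §1 Group algebra: a section times a transition -/

/-- ★ **(Σ-1) SECTION × TRANSITION STEP**: `dist1 ((w₁·t₁)·(w₂·t₂)⁻¹) ≤ dist1 (w₁·w₂⁻¹) + dist1 (t₁⁻¹·t₂)` in any gauge group (conjugation invariance).
[folklore] -/
theorem dist1_mul_mul_inv_mul_le {G : Type*} [GaugeGroup G] (w₁ t₁ w₂ t₂ : G) :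
    dist1 ((w₁ * t₁) * (w₂ * t₂)⁻¹) ≤ dist1 (w₁ * w₂⁻¹) + dist1 (t₁⁻¹ * t₂) := by
  have h1 : (w₁ * t₁) * (w₂ * t₂)⁻¹ = w₂ * ((w₂⁻¹ * w₁) * (t₁ * t₂⁻¹)) * w₂⁻¹ := by group
  rw [h1, GaugeGroup.dist1_conj]
  have h2 : dist1 (w₂⁻¹ * w₁) = dist1 (w₁ * w₂⁻¹) := by
    have := GaugeGroup.dist1_conj (w₂⁻¹ * w₁) w₂
    rw [← this]; congr 1; group
  have h3 : dist1 (t₁ * t₂⁻¹) = dist1 (t₁⁻¹ * t₂) := by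
    have := GaugeGroup.dist1_conj (t₂⁻¹ * t₁) t₁
    rw [show t₁ * (t₂⁻¹ * t₁) * t₁⁻¹ = t₁ * t₂⁻¹ by group] at this
    rw [this, ← GaugeGroup.dist1_inv]; congr 1; group
  calc dist1 ((w₂⁻¹ * w₁) * (t₁ * t₂⁻¹)) ≤ dist1 (w₂⁻¹ * w₁) + dist1 (t₁ * t₂⁻¹) := GaugeGroup.dist1_mul_le _ _
    _ = dist1 (w₁ * w₂⁻¹) + dist1 (t₁⁻¹ * t₂) := by rw [h2, h3]

/-! ## §2 The eight-colour table -/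

section Table
variable {P : Params} {M : ℕ} (κ0 κ1 κ2 : Fin P.d)
  (W₁ : (Fin P.d → Fin M) → Fin P.d → Site P 0 → SU2)
  (W₂ : (Fin P.d → Fin M) → Fin P.d → Fin P.d → Site P 0 → SU2)
  (W₃ : (Fin P.d → Fin M) → Site P 0 → SU2)
  (wle1 wle2 w : (Fin P.d → Fin M) → Site P 0 → SU2)
  (hwle1 : ∀ R x, wle1 R x =
    if ((R κ0 : Fin M) : ℕ) % 2 = 1 then (if ((R κ1 : Fin M) : ℕ) % 2 = 1 then 1 else if ((R κ2 : Fin M) : ℕ) % 2 = 1 then 1 else W₁ R κ0 x)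
    else (if ((R κ1 : Fin M) : ℕ) % 2 = 1 then (if ((R κ2 : Fin M) : ℕ) % 2 = 1 then 1 else W₁ R κ1 x)
      else (if ((R κ2 : Fin M) : ℕ) % 2 = 1 then W₁ R κ2 x else 1)))
  (hwle2 : ∀ R x, wle2 R x =
    if ((R κ0 : Fin M) : ℕ) % 2 = 1 then (if ((R κ1 : Fin M) : ℕ) % 2 = 1 then (if ((R κ2 : Fin M) : ℕ) % 2 = 1 then 1 else W₂ R κ0 κ1 x)
      else (if ((R κ2 : Fin M) : ℕ) % 2 = 1 then W₂ R κ0 κ2 x else W₁ R κ0 x))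
    else (if ((R κ1 : Fin M) : ℕ) % 2 = 1 then (if ((R κ2 : Fin M) : ℕ) % 2 = 1 then W₂ R κ1 κ2 x else W₁ R κ1 x)
      else (if ((R κ2 : Fin M) : ℕ) % 2 = 1 then W₁ R κ2 x else 1)))
  (hw : ∀ R x, w R x =
    if ((R κ0 : Fin M) : ℕ) % 2 = 1 then (if ((R κ1 : Fin M) : ℕ) % 2 = 1 then (if ((R κ2 : Fin M) : ℕ) % 2 = 1 then W₃ R x else W₂ R κ0 κ1 x)
      else (if ((R κ2 : Fin M) : ℕ) % 2 = 1 then W₂ R κ0 κ2 x else W₁ R κ0 x))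
    else (if ((R κ1 : Fin M) : ℕ) % 2 = 1 then (if ((R κ2 : Fin M) : ℕ) % 2 = 1 then W₂ R κ1 κ2 x else W₁ R κ1 x)
      else (if ((R κ2 : Fin M) : ℕ) % 2 = 1 then W₁ R κ2 x else 1)))

include hwle1 hw in
/-- The stage-≤1 table agrees with the full table off the stage-≥2 colours. [folklore] -/
theorem wle1_eq_w (R : Fin P.d → Fin M) (x : Site P 0)
    (h : ¬ ((((R κ0 : Fin M) : ℕ) % 2 = 1 ∧ ((R κ1 : Fin M) : ℕ) % 2 = 1) ∨ (((R κ0 : Fin M) : ℕ) % 2 = 1 ∧ ((R κ2 : Fin M) : ℕ) % 2 = 1) ∨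
      (((R κ1 : Fin M) : ℕ) % 2 = 1 ∧ ((R κ2 : Fin M) : ℕ) % 2 = 1))) : wle1 R x = w R x := by
  rw [hwle1, hw]
  by_cases h0 : ((R κ0 : Fin M) : ℕ) % 2 = 1 <;> by_cases h1 : ((R κ1 : Fin M) : ℕ) % 2 = 1 <;>
    by_cases h2 : ((R κ2 : Fin M) : ℕ) % 2 = 1 <;> simp_all

include hwle2 hw in
/-- The stage-≤2 table agrees with the full table off the stage-3 colour. [folklore] -/
theorem wle2_eq_w (R : Fin P.d → Fin M) (x : Site P 0)
    (h : ¬ (((R κ0 : Fin M) : ℕ) % 2 = 1 ∧ ((R κ1 : Fin M) : ℕ) % 2 = 1 ∧ ((R κ2 : Fin M) : ℕ) % 2 = 1)) : wle2 R x = w R x := by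
  rw [hwle2, hw]
  by_cases h0 : ((R κ0 : Fin M) : ℕ) % 2 = 1 <;> by_cases h1 : ((R κ1 : Fin M) : ℕ) % 2 = 1 <;>
    by_cases h2 : ((R κ2 : Fin M) : ℕ) % 2 = 1 <;> simp_all

include hw in
/-- Colour `(0,0,0)`: the section is `1`. [folklore] -/
theorem w_eq_one (R : Fin P.d → Fin M) (x : Site P 0) (h0 : ¬ ((R κ0 : Fin M) : ℕ) % 2 = 1) (h1 : ¬ ((R κ1 : Fin M) : ℕ) % 2 = 1)
    (h2 : ¬ ((R κ2 : Fin M) : ℕ) % 2 = 1) : w R x = 1 := by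
  rw [hw]; simp only [h0, h1, h2, if_false]

include hw in
/-- Colours of stage 1: the section is `W₁ R α`. [folklore] -/
theorem w_eq_W1 (R : Fin P.d → Fin M) (x : Site P 0) (α : Fin P.d)
    (hα : (α = κ0 ∧ ((R κ0 : Fin M) : ℕ) % 2 = 1 ∧ ¬ ((R κ1 : Fin M) : ℕ) % 2 = 1 ∧ ¬ ((R κ2 : Fin M) : ℕ) % 2 = 1) ∨
      (α = κ1 ∧ ¬ ((R κ0 : Fin M) : ℕ) % 2 = 1 ∧ ((R κ1 : Fin M) : ℕ) % 2 = 1 ∧ ¬ ((R κ2 : Fin M) : ℕ) % 2 = 1) ∨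
      (α = κ2 ∧ ¬ ((R κ0 : Fin M) : ℕ) % 2 = 1 ∧ ¬ ((R κ1 : Fin M) : ℕ) % 2 = 1 ∧ ((R κ2 : Fin M) : ℕ) % 2 = 1)) : w R x = W₁ R α x := by
  rw [hw]
  rcases hα with ⟨rfl, h0, h1, h2⟩ | ⟨rfl, h0, h1, h2⟩ | ⟨rfl, h0, h1, h2⟩ <;> simp only [h0, h1, h2, if_true, if_false]

include hw in
/-- Colours of stage 2: the section is `W₂ R α β`. [folklore] -/
theorem w_eq_W2 (R : Fin P.d → Fin M) (x : Site P 0) (α β : Fin P.d)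
    (hαβ : (α = κ0 ∧ β = κ1 ∧ ((R κ0 : Fin M) : ℕ) % 2 = 1 ∧ ((R κ1 : Fin M) : ℕ) % 2 = 1 ∧ ¬ ((R κ2 : Fin M) : ℕ) % 2 = 1) ∨
      (α = κ0 ∧ β = κ2 ∧ ((R κ0 : Fin M) : ℕ) % 2 = 1 ∧ ¬ ((R κ1 : Fin M) : ℕ) % 2 = 1 ∧ ((R κ2 : Fin M) : ℕ) % 2 = 1) ∨
      (α = κ1 ∧ β = κ2 ∧ ¬ ((R κ0 : Fin M) : ℕ) % 2 = 1 ∧ ((R κ1 : Fin M) : ℕ) % 2 = 1 ∧ ((R κ2 : Fin M) : ℕ) % 2 = 1)) :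
    w R x = W₂ R α β x := by
  rw [hw]
  rcases hαβ with ⟨rfl, rfl, h0, h1, h2⟩ | ⟨rfl, rfl, h0, h1, h2⟩ | ⟨rfl, rfl, h0, h1, h2⟩ <;> simp only [h0, h1, h2, if_true, if_false]

include hw in
/-- Colour `(1,1,1)`: the section is `W₃ R`. [folklore] -/
theorem w_eq_W3 (R : Fin P.d → Fin M) (x : Site P 0) (h0 : ((R κ0 : Fin M) : ℕ) % 2 = 1) (h1 : ((R κ1 : Fin M) : ℕ) % 2 = 1)
    (h2 : ((R κ2 : Fin M) : ℕ) % 2 = 1) : w R x = W₃ R x := by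
  rw [hw]; simp only [h0, h1, h2, if_true]

end Table

end Summit.QuantumFields.YangMills.Theorems.FluctuationComparisonRegPrIntLS2BetaSectionsColourTable
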